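import Summits.QuantumFields.BalabanUV.T4Continuum.Support.NE9EndOfRecordPrint

/-!
# NE9EndOfRecordCentre — ROW NE9's END OF RECORD READ AT THE CHART CENTRE: the base point `pt := 0`, the REAL-SLICE AGREEMENT of
# the activities of record `actOR` AT THE CENTRE (operator half: `NE9ChartFaceOperator.oRecC_zero` on `slotsOfRecord_rawB`; table half:
# `iRecC P cc w k s 0` stated as what it is), and the VACUUM-PAIR READING of `actOR` beyond the cut-off `ρ` (the END's subtraction point
# `U₀`; `oRecC_of_lt`) — the dictionary lines node U3 ∕ the NE4 instancer consume when they read the END's functional `EreOf … (fun _ ↦ 0)`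
# as a functional of the REAL run-B background (cell `pub-balaban`, T4-DAG §2 node U3 ∕ §6 NE9; BINDER row NE9 OWNER lineage
# `b2b-balaban-t4-ne9-p1`, generation 37; record `t4/T4-EST-NE9-P1.md` §43.8 items (b)∕(c); nothing of any import modified;
# v1.1 (same generation, APPEND-ONLY, §§1–4 byte-identical): §5 the letters READ THROUGH THE TOWER DATA `SlotLetters.readB` and the
# hypothesis-free centre agreement `actOR_zero_readB`)

HONEST FRAMING (T4-DAG PAGE 1).  Rung (B)+1 of the FINITE-VOLUME T⁴ programme — NOT infinite volume, NOT a mass gap, NOT the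
Clay problem.  NE9 (`T4OutputRate.NE9` ∧ `FadingMemory`) is a cell NEW ESTIMATE, NOT PRINTED in [I] = [Balaban1987RG1]
(CMP **109**), [II] = [Balaban1988RG2Cluster] (CMP **116**), [B9] = [Balaban1985BackgroundPropagators] (CMP **99**), and NOT PROVED
for Bałaban's E^{(j)} («NE9 ⇐ the named binders»; spine PROVED 0∕9).  HONEST DEPENDENCY (cell line, verbatim): continuum YM on T⁴ ⇐
BetaPertH ∧ nine spine estimates (0/9 proved); BetaPertH ⇐ (D1) ∧ (D4) ∧ CAP+tail; G-an2-4 gates asym, D1 and NE2/3/4.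
`FlowStep.BetaPertH`, (B), (B^μ) do not occur.  IDENTITIES + ONE specialisation BY NAME; no inequality of Bałaban's asserted
(ABSOLUTE RULE); quotations for TYPES ∕ loci only; 0 sorry.

WHAT IS HERE (record §43.8 (b)(c), the two owner-buildable items that need no substrate event).
§1 **`actOR_zero`** — AT THE CHART CENTRE THE ACTIVITIES OF RECORD ARE THE REAL-SLICE ACTIVITIES OF RECORD: if the run-B kernel ∕
   potential tables of the letters `L` ARE the tower-data readings of the chart-level tables `dk gc pQ pR` (hypotheses `hdk hgc hpQ hpR` —
   the identification the substrate's `SubstrateTransporterSpecies.rawOfRecord_eq_rawTOfRecord` is stated for), `ιR` is unitary-valued and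
   `0 ≤ ρ`, then `actOR … U k s 0 Q = actNE9 (slotsOfRecord …) (oRecLast (slotsOfRecord …)) (k s _ Q ↦ iRecC P cc w k s 0 Q) k s U Q` —
   NE9's activity of record (p218863 `actNE9`) at NE5's `Slots` of record with the LAST-COUPLING operator datum `oRecLast` (p219089) at the
   REAL background `U`.  Operator half = `oRecC_zero`; the table half is the identity map on what `iRecC` reads at the centre (the
   coordinate identification `cc k 0` is the instancer's, R48-F; nothing about it is claimed).
§2 **`actOR_of_lt`** — BEYOND THE CUT-OFF THE ACTIVITIES OF RECORD READ THE VACUUM PAIR: for `ρ < ‖A‖`,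
   `actOR … U k s A Q = actNE9 (slotsOfRecord …) (k s _ _ ↦ assemble ((L.W (k+1)).format) (rawTKernel … (const s) vacPair (k+1))) (k s _ Q ↦ iRecC P cc w k s A Q) k s U Q`
   — so the END's vacuum-subtraction point `U₀ U` ([I] (2.14) p. 268 «log 𝐍″_k = 𝐄^{(k+1)}(g_k, 1)») may be ANY chart point beyond `ρ`,
   uniformly in the real background.
§3 **`EreOf_centre`** — the END's functional read at `pt := 0` is, at the real background `U`, the recursion-defined functional of the
   chart activities `actOR … U` at the chart point `0` (`rfl`), whose activities §1 identifies.
§4 **`termSize_ne9_and_fadingMemory_centre`** — `NE9EndOfRecordPrint.termSize_ne9_and_fadingMemory_print` (T25) at `pt := fun _ ↦ 0`: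
   every hypothesis verbatim, conclusion LITERALLY the END's `TermSize ∧ NE9 ∧ FadingMemory` for `EreOf … (fun _ ↦ 0)`.
§5 (v1.1) **`SlotLetters.readB L dk gc pQ pR`** — the letters `L` with run B's kernel ∕ potential tables REPLACED by the tower-data readings of the
   chart-level tables (the substrate's design: `rawOfRecord_eq_rawTOfRecord` reads the species on two-sided tower data); at these letters the four
   reading hypotheses of §1 hold by `rfl` — **`actOR_zero_readB`**: the centre agreement with NO reading hypothesis (`ιR` unitary, `0 ≤ ρ` only).
NOT HERE (named owners, unchanged): the species' analytic fields `cur ∕ ker` (⇐ substrate D-8 (v) object), the table identification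
`cc ∕ w` and its agreement with NE5's `iRecLast` (R48-F), the (R-1)∕T∕S rows of WALL-NE9-P1 §2.  DISGUISE TEST: `rfl`∕`rw`-level
identities and one specialisation; no estimate.

References (TYPES ∕ loci only): [Balaban1985BackgroundPropagators] T. Bałaban, CMP **99** (1985) 389–434, Sect. B pp. 399–400;
[Balaban1987RG1] T. Bałaban, CMP **109** (1987) 249–301, Thm 1 p. 259, (1.18) p. 263, (2.13)–(2.14) p. 268, p. 270;
[Balaban1988RG2Cluster] T. Bałaban, CMP **116** (1988) 1–22, (1.23)–(1.29) pp. 7–8, (1.33)–(1.36) p. 9, (2.14)–(2.15) p. 15.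
Summits-side NEW work (LEAN PLACEMENT RULE); imports `NE9EndOfRecordPrint` (p235043) ONLY; modifies nothing.  Value = the
row's dictionary at the chart centre + the END under the centre reading, NOT summit progress.
-/

noncomputable section

namespace Summit.QuantumFields.BalabanUV.T4Continuum.NE9EndOfRecordCentre

open scoped BigOperators ENNReal Matrix Matrix.Norms.L2Operator
open Metric Set
open Literature.Probability.LatticeModels
open Literature.MathematicalPhysics.QuantumFieldTheory.Balaban1983to89
open Literature.MathematicalPhysics.QuantumFieldTheory.Balaban1983to89.T4OutputRate
open Literature.MathematicalPhysics.QuantumFieldTheory.Balaban1983to89.T4HistoryLipschitzRecursion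
open Literature.MathematicalPhysics.QuantumFieldTheory.Balaban1983to89.T4HistoryLipschitzOuter
open Literature.MathematicalPhysics.QuantumFieldTheory.Balaban1983to89.T4HistoryLipschitzActivity
open Literature.MathematicalPhysics.QuantumFieldTheory.Balaban1983to89.T4HistoryLipschitzActivity (ClusterGeom)
open Literature.MathematicalPhysics.QuantumFieldTheory.Balaban1983to89.T4HistoryLipschitzSegment
open Summit.QuantumFields.BalabanUV.T4Continuum.B13Carriers (TwoRuns)
open Summit.QuantumFields.BalabanUV.T4Continuum.B13DomainGeometryTR
open Summit.QuantumFields.BalabanUV.T4Continuum.B13OpDatum (OpDatum assemble)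
open Summit.QuantumFields.BalabanUV.T4Continuum.NE9Lemma1Counting
open Summit.QuantumFields.BalabanUV.T4Continuum.NE9Lemma1Gain
open Summit.QuantumFields.BalabanUV.T4Continuum.NE9Lemma1PieceClass
open Summit.QuantumFields.BalabanUV.T4Continuum.NE9Lemma1RemainderSpecies
open Summit.QuantumFields.BalabanUV.T4Continuum.NE9Lemma1CurveSpecies
open Summit.QuantumFields.BalabanUV.T4Continuum.NE9Lemma1KernelSpecies
open Summit.QuantumFields.BalabanUV.T4Continuum.NE9ComplexEncoding (doubleCarriers)
open Summit.QuantumFields.BalabanUV.T4Continuum.NE9MarginalProjection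
open Summit.QuantumFields.BalabanUV.T4Continuum.NE9MarginalProjectionEnd
open Summit.QuantumFields.BalabanUV.T4Continuum.NE9ChannelSum
open Summit.QuantumFields.BalabanUV.T4Continuum.NE9SizeFedCoupling
open Summit.QuantumFields.BalabanUV.T4Continuum.NE9TableReading
open Summit.QuantumFields.BalabanUV.T4Continuum.NE9RecursionFunctional
open Summit.QuantumFields.BalabanUV.T4Continuum.NE9EndApplied
open Summit.QuantumFields.BalabanUV.T4Continuum.NE9ChartFamilyPullback
open Summit.QuantumFields.BalabanUV.T4Continuum.NE9EndAppliedRealRow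
open Summit.QuantumFields.BalabanUV.T4Continuum.NE9SpeciesFrameOfRecord
open Summit.QuantumFields.BalabanUV.T4Continuum.NE9SpeciesDataOfRecord
open Summit.QuantumFields.BalabanUV.T4Continuum.NE9SpeciesDataOfRecordAdmissible
open Summit.QuantumFields.BalabanUV.T4Continuum.NE9EndOfRecordSpecies
open Summit.QuantumFields.BalabanUV.T4Continuum.NE9SpeciesFrameConvention
open Summit.QuantumFields.BalabanUV.T4Continuum.NE9SpeciesDataConvention
open Summit.QuantumFields.BalabanUV.T4Continuum.NE9EndOfRecordConvention
open Summit.QuantumFields.BalabanUV.T4Continuum.NE9EndOfRecordAct (GoR actOR)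
open Summit.QuantumFields.BalabanUV.T4Continuum.NE9EndOfRecordActConvention
open Summit.QuantumFields.BalabanUV.T4Continuum.NE9EndOfRecordPrint
open Summit.QuantumFields.BalabanUV.T4Continuum.NE9DoubledChart (dblChart)
open Summit.QuantumFields.BalabanUV.T4Continuum.B13CarriersCubeChart (cubeChart)
open Summit.QuantumFields.BalabanUV.T4Continuum.B13HistDatum
open Summit.QuantumFields.BalabanUV.T4Continuum.B13HistMeasurable
open Summit.QuantumFields.BalabanUV.T4Continuum.B13StepTermLabels (InnerLabel)
open Summit.QuantumFields.BalabanUV.T4Continuum.B13InnerData (Bnd)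
open Summit.QuantumFields.BalabanUV.T4Continuum.CovariantBlockAveraging (ContourSystem)
open Literature.MathematicalPhysics.QuantumFieldTheory.Balaban1983to89.B5Prop11Plancherel (Tor)
open Literature.MathematicalPhysics.QuantumFieldTheory.Balaban1983to89.B5G183RateUnitTower (lev)
open Literature.MathematicalPhysics.QuantumFieldTheory.Balaban1983to89.T4HistoryLipschitzCubeGeometry (CubeChart)
open Summit.QuantumFields.BalabanUV.T4Continuum.SubstrateBackgroundTransporters (unitMod)
open Summit.QuantumFields.BalabanUV.T4Continuum.SubstrateTwoRunsDriven (DrivenRuns)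
open Summit.QuantumFields.BalabanUV.T4Continuum.SubstrateTransporterSpecies (TowerData towerDataOf adjOf)
open Summit.QuantumFields.BalabanUV.T4Continuum.SubstrateSlotsOfRecord (SlotLetters slotsOfRecord slotsOfRecord_rawB slotsOfRecord_F)
open Summit.QuantumFields.BalabanUV.T4Continuum.NE9ChartFaceOperator (actChart rawTKernel towerPairChart vacPair oRecC_zero oRecC_of_lt)
open Summit.QuantumFields.BalabanUV.T4Continuum.NE9ChartFaceTable (iRecC)
open Summit.QuantumFields.BalabanUV.T4Continuum.U3PolymerDictionaryNE9Face (actNE9 oRecLast)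
open Summit.QuantumFields.BalabanUV.T4Continuum.U3PolymerDictionaryLift (liftFam)

variable {G₀ : Type} [GaugeGroup G₀] (D : DrivenRuns G₀)

/-! ## §0 The letters of the activities of record (as in `NE9EndOfRecordAct` ∕ `NE9EndOfRecordPrint`) -/

variable {o : Type} [Fintype o] [DecidableEq o] (ιR : G₀ →* Matrix o o ℂ) (cR : ℂ) (aR : ℝ) (sR : ℕ → ℂ)
variable {T ι' S Ω 𝒴 : Type} (P : MeasPotFrame D.carriers) {IOp : Type*}
  (𝒵 : D.carriers.Dom → InnerLabel D.carriers.Dom (Bnd D.toTwoRuns) → Type) [∀ Z j, Fintype (𝒵 Z j)]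
  (dom : ∀ Z j, 𝒵 Z j → D.carriers.Dom)
  (Jc : D.carriers.Dom → InnerLabel D.carriers.Dom (Bnd D.toTwoRuns) → Type) [∀ Z j, Fintype (Jc Z j)]
  (VR : D.carriers.Dom → InnerLabel D.carriers.Dom (Bnd D.toTwoRuns) → Type) [∀ Z j, NormedAddCommGroup (VR Z j)]
  [∀ Z j, InnerProductSpace ℝ (VR Z j)] [∀ Z j, MeasurableSpace (VR Z j)] [∀ Z j, BorelSpace (VR Z j)] [∀ Z j, FiniteDimensional ℝ (VR Z j)]
  (mI : D.carriers.Dom → InnerLabel D.carriers.Dom (Bnd D.toTwoRuns) → Type) [∀ Z j, Fintype (mI Z j)] [∀ Z j, DecidableEq (mI Z j)]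
  (L : SlotLetters D (o := o) (T := T) (ι' := ι') (S := S) (Ω := Ω) (𝒴 := 𝒴) P (IOp := IOp) 𝒵 dom Jc VR mI)
  (dk : TowerData (D.F.P (D.K + 1)) o → TowerData (D.F.P (D.K + 1)) o → ℕ → T → ι' → ι' → ℂ)
  (gc : TowerData (D.F.P (D.K + 1)) o → TowerData (D.F.P (D.K + 1)) o → ℕ → T →
    ((Tor (unitMod (D.F.P (D.K + 1))) × Fin (D.F.P (D.K + 1)).d) × o) → ι' → ℂ)
  (pQ : ℝ → TowerData (D.F.P (D.K + 1)) o → TowerData (D.F.P (D.K + 1)) o → ℕ → Ω → 𝒴 →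
    ((Tor (unitMod (D.F.P (D.K + 1))) × Fin (D.F.P (D.K + 1)).d) × o) → ((Tor (unitMod (D.F.P (D.K + 1))) × Fin (D.F.P (D.K + 1)).d) × o) → ℂ)
  (pR : ℝ → TowerData (D.F.P (D.K + 1)) o → TowerData (D.F.P (D.K + 1)) o → ℕ → Ω → 𝒴 → ℂ)
  (ρ : ℝ) {ι τ : Type} [Fintype τ] (cc : ℕ → TowerData (D.F.P (D.K + 1)) o → PotIdx P.toPotFrame → τ → ι) (wR : τ → ℂ)

/-! ## §1 At the chart centre: the activities of record are the real-slice activities of record -/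

/-- **REAL-SLICE AGREEMENT OF THE ACTIVITIES OF RECORD AT THE CHART CENTRE.**  If the run-B kernel ∕ potential tables of `L` are the
tower-data readings of `dk gc pQ pR` (the identification `rawOfRecord_eq_rawTOfRecord` speaks about), `ιR` is unitary-valued and `0 ≤ ρ`,
then at the chart point `0` the activities of record ARE NE9's activity of record at NE5's `Slots` of record with the last-coupling
operator datum at the REAL background `U` (operator half `oRecC_zero`; the table slot reads `iRecC P cc w k s 0`).
[cite: Balaban1985BackgroundPropagators, Sect. B pp.399-400; Balaban1988RG2Cluster, (2.14) p.15] -/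
theorem actOR_zero (hι : ∀ g, ιR g ∈ Matrix.unitaryGroup o ℂ) (hρ : 0 ≤ ρ)
    (hdk : L.dkB = fun U k => dk (towerDataOf (D.F.P (D.K + 1)) ιR D.avB U) (fun k => adjOf (towerDataOf (D.F.P (D.K + 1)) ιR D.avB U k)) k)
    (hgc : L.gcB = fun U k => gc (towerDataOf (D.F.P (D.K + 1)) ιR D.avB U) (fun k => adjOf (towerDataOf (D.F.P (D.K + 1)) ιR D.avB U k)) k)
    (hpQ : L.pQB = fun r U k => pQ r (towerDataOf (D.F.P (D.K + 1)) ιR D.avB U) (fun k => adjOf (towerDataOf (D.F.P (D.K + 1)) ιR D.avB U k)) k)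
    (hpR : L.pRB = fun r U k => pR r (towerDataOf (D.F.P (D.K + 1)) ιR D.avB U) (fun k => adjOf (towerDataOf (D.F.P (D.K + 1)) ιR D.avB U k)) k)
    (U : D.carriers.BgB) (k : ℕ) (s : ℝ) (Q : lp (fun _ : ι => ℂ) ∞) :
    actOR D ιR cR aR sR P 𝒵 dom Jc VR mI L dk gc pQ pR ρ cc wR U k s 0 Q =
      actNE9 (slotsOfRecord D ιR cR aR sR P 𝒵 dom Jc VR mI L) (oRecLast (slotsOfRecord D ιR cR aR sR P 𝒵 dom Jc VR mI L))
        (fun k s (_ : D.carriers.BgB) Q => iRecC P cc wR k s (0 : TowerData (D.F.P (D.K + 1)) o) Q) k s U Q := by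
  have hcentre := oRecC_zero (D.F.P (D.K + 1)) ιR D.avB cR aR sR L.ΓB dk gc pQ pR hι
    (slotsOfRecord D ιR cR aR sR P 𝒵 dom Jc VR mI L) (fun V : D.carriers.BgB => V.1)
    (fun g V k' => by rw [slotsOfRecord_rawB]; unfold SubstrateRawSpecies.rawBOfRecord; rw [hdk, hgc, hpQ, hpR]) hρ U k s Q
  unfold actOR actChart actNE9 liftFam
  beta_reduce
  erw [hcentre]
  rfl

/-! ## §2 Beyond the cut-off: the activities of record read the vacuum pair -/

/-- **THE VACUUM READING BEYOND THE CUT-OFF.**  For a chart point `A` with `ρ < ‖A‖` the operator datum sourced on the tower pair chart is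
the one assembled from run B's raw kernel of record at the VACUUM PAIR (`oRecC_of_lt`), for every real background `U`: the END's
vacuum-subtraction point `U₀ U` may be any such `A`. [cite: Balaban1987RG1, (2.14) p.268] -/
theorem actOR_of_lt {A : TowerData (D.F.P (D.K + 1)) o} (hA : ρ < ‖A‖) (U : D.carriers.BgB) (k : ℕ) (s : ℝ) (Q : lp (fun _ : ι => ℂ) ∞) :
    actOR D ιR cR aR sR P 𝒵 dom Jc VR mI L dk gc pQ pR ρ cc wR U k s A Q =
      actNE9 (slotsOfRecord D ιR cR aR sR P 𝒵 dom Jc VR mI L)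
        (fun k s (_ : D.carriers.BgB) (_ : lp (fun _ : ι => ℂ) ∞) =>
          assemble ((L.W (k + 1)).format) (rawTKernel (D.F.P (D.K + 1)) cR aR sR L.ΓB dk gc pQ pR (fun _ => s) (vacPair (D.F.P (D.K + 1))) (k + 1)))
        (fun k s (_ : D.carriers.BgB) Q => iRecC P cc wR k s A Q) k s U Q := by
  have hvac := oRecC_of_lt (D.F.P (D.K + 1)) cR aR sR L.ΓB dk gc pQ pR (slotsOfRecord D ιR cR aR sR P 𝒵 dom Jc VR mI L)
    (towerDataOf (D.F.P (D.K + 1)) ιR D.avB U.1) hA k s Q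
  unfold actOR actChart actNE9 liftFam
  beta_reduce
  erw [hvac]
  rfl

/-- **THE VACUUM READING IS BACKGROUND-FREE**: beyond the cut-off the activities of record at two real backgrounds coincide. [folklore] -/
theorem actOR_of_lt_eq {A : TowerData (D.F.P (D.K + 1)) o} (hA : ρ < ‖A‖) (U U' : D.carriers.BgB) (k : ℕ) (s : ℝ)
    (Q : lp (fun _ : ι => ℂ) ∞) :
    actOR D ιR cR aR sR P 𝒵 dom Jc VR mI L dk gc pQ pR ρ cc wR U k s A Q =
      actOR D ιR cR aR sR P 𝒵 dom Jc VR mI L dk gc pQ pR ρ cc wR U' k s A Q := by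
  rw [actOR_of_lt D ιR cR aR sR P 𝒵 dom Jc VR mI L dk gc pQ pR ρ cc wR hA U,
    actOR_of_lt D ιR cR aR sR P 𝒵 dom Jc VR mI L dk gc pQ pR ρ cc wR hA U']
  rfl

/-! ## §3 The END's functional read at the centre -/

/-- **THE END's FUNCTIONAL AT `pt := 0`** is, at the real background `U`, the recursion-defined functional of the chart activities
`actOR … U` at the chart point `0`, on the `re` copy (`rfl`). [cite: Balaban1987RG1, (1.18) p.263 and (2.13)-(2.14) p.268] -/
theorem EreOf_centre (wt : D.carriers.BgB → ℕ → ι → ℝ) (U₀ : D.carriers.BgB → TowerData (D.F.P (D.K + 1)) o)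
    (explZ : D.carriers.BgB → ℕ → TowerData (D.F.P (D.K + 1)) o → (doubleCarriers D.carriers).Dom → ℝ)
    (base : D.carriers.BgB → TowerData (D.F.P (D.K + 1)) o → (doubleCarriers D.carriers).Dom → ℝ)
    (𝒯 : D.carriers.BgB → ℕ → (ℕ → ℝ) → (TowerData (D.F.P (D.K + 1)) o → (doubleCarriers D.carriers).Dom → ℝ) → ι → ℝ)
    (Pj : D.carriers.BgB → (TowerData (D.F.P (D.K + 1)) o → (doubleCarriers D.carriers).Dom → ℝ) →
      (TowerData (D.F.P (D.K + 1)) o → (doubleCarriers D.carriers).Dom → ℝ)) (g : ℕ → ℝ) (U : D.carriers.BgB) (X : D.carriers.Dom) :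
    EreOf (GoR D) (actOR D ιR cR aR sR P 𝒵 dom Jc VR mI L dk gc pQ pR ρ cc wR) wt U₀ explZ base 𝒯 Pj (fun _ => 0) g U X =
      EfOf (GoR D) (actOR D ιR cR aR sR P 𝒵 dom Jc VR mI L dk gc pQ pR ρ cc wR U) (wt U) (U₀ U) (explZ U) (base U) (𝒯 U) (Pj U) g 0 (X, true) :=
  rfl

/-! ## §4 The END of record read at the chart centre -/

/-- **ROW NE9's END OF RECORD READ AT THE CHART CENTRE.**  `NE9EndOfRecordPrint.termSize_ne9_and_fadingMemory_print` (T25) at the base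
point `pt := fun _ ↦ 0`: the END's functional is, background by background, the recursion-defined functional of the activities of record
`actOR … U` at the centre of the tower pair chart at `U` (§3), i.e. — under §1's reading hypotheses — of NE9's activity of record at NE5's
`Slots` of record with the last-coupling operator datum at the REAL background.  Every hypothesis T25's verbatim; conclusion LITERALLY
the END's `TermSize ∧ NE9 ∧ FadingMemory`. [cite: Balaban1987RG1, Thm 1 p.259, (1.18) p.263, (2.13)-(2.14) p.268, p.270; Balaban1988RG2Cluster, (1.23)-(1.29) pp.7-8, (1.33)-(1.36) p.9, (2.14)-(2.15) p.15] -/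
theorem termSize_ne9_and_fadingMemory_centre {Pt : Type} [Nonempty ι] (U₁ : D.carriers.BgB)
    (𝔭 : SpeciesParams D.toTwoRuns D.carriers.BgB (TowerData (D.F.P (D.K + 1)) o) ι Pt)
    {ℓg gain : ℕ → ℕ → ℝ} (ℓk : ℕ → ℕ → ℝ) {cdir cK δ₀ δ₁ w w0 c0 c1 cQa cQb : ℝ} {W : Set (ℕ → ℝ)}
    {Adm MF : D.carriers.BgB → Set (TowerData (D.F.P (D.K + 1)) o → (doubleCarriers D.carriers).Dom → ℝ)}
    {r : D.carriers.BgB → ℕ → (TowerData (D.F.P (D.K + 1)) o → (doubleCarriers D.carriers).Dom → ℝ) → ℝ}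
    {A : D.carriers.BgB → TowerData (D.F.P (D.K + 1)) o → (doubleCarriers D.carriers).Dom → ℝ}
    {n : D.carriers.BgB → ℕ → ℝ → TowerData (D.F.P (D.K + 1)) o → Finset (SCube D.toTwoRuns) → ℝ} {lip clip : ℕ → ℝ} {a d : Finset (SCube D.toTwoRuns) → ℝ} {δv : (doubleCarriers D.carriers).Dom → ℝ}
    {κ B lipbar clipbar qTbar ω cr aA Nbar clipa lam : ℝ} {p₀ N : ℕ → ℝ}
    -- species (a): the analytic clauses of `CurData.Admissible` at the data of record, and the letters
    (hκ₁1 : 1 ≤ 𝔭.κ₁) (hrT : ∀ k, 0 < 𝔭.rT k) (hRad : ∀ X, 0 < 𝔭.Rad X)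
    (hcur : ∀ (U : D.carriers.BgB) (k : ℕ) (s : ℕ → ℝ) (y : ι) (a : SCube D.toTwoRuns) (b : Finset (SCube D.toTwoRuns)) (x : (doubleCarriers D.carriers).Dom),
      ∀ t ∈ sphere (0:ℂ) (𝔭.rT k), ∀ (s' : SCube D.toTwoRuns → ℝ) (σ' : SCube D.toTwoRuns → ℂ), OnContour 𝔭.κ₁ (cubesListC D.toTwoRuns (printConvention D.toTwoRuns) k a b) s' σ' →
        DifferentiableOn ℂ (𝔭.cur U k s y a b x t s' σ') (ball 0 (𝔭.ϱ U k s y a b x)) ∧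
          MapsTo (𝔭.cur U k s y a b x t s' σ') (ball 0 (𝔭.ϱ U k s y a b x)) (ball 0 (𝔭.Rad x.1)))
    (hϱgt : ∀ U k s y a b x, 1 < 𝔭.ϱ U k s y a b x)
    (hϱinv : ∀ (U : D.carriers.BgB) (k : ℕ) (s : ℕ → ℝ) (y : ι), ∀ a ∈ boxes D.toTwoRuns k (𝔭.Yout k y), ∀ b ∈ famC D.toTwoRuns (printConvention D.toTwoRuns) k (𝔭.Yout k y) a,
      ∀ (j : ℕ), ∀ x ∈ srcC D.toTwoRuns (printConvention D.toTwoRuns) k a j, (𝔭.ϱ U k s y a b x)⁻¹ ≤ cdir * ℓg k j)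
    (hℓ : ∀ k j, 0 < ℓg k j) (hκ : 144 ≤ κ) (hκ₁ : 69 ≤ 𝔭.κ₁)
    (hLaℓ : ∀ k j, j ≤ k → (1296 : ℝ) * ((D.F.L : ℝ) ^ 4) ^ (k - j) * ℓg k j ^ 5 ≤ cQa * agePow ω k j)
    (hAa : ∀ U, PieceAdditiveOn (analyticClass (𝔭.DC (printConvention D.toTwoRuns) U).R) (𝔭.DC (printConvention D.toTwoRuns) U).toC)
    (hclipa : 0 ≤ clipa) (hcdir : 0 < cdir) (hhalf : ∀ k j, cdir * ℓg k j < 1 / 2)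
    (hcont : ∀ U, ∀ (k : ℕ) (s : ℕ → ℝ) (y : ι) (a : SCube D.toTwoRuns) (b : Finset (SCube D.toTwoRuns)) (x : (doubleCarriers D.carriers).Dom),
      ContinuousOn (fun q : (ℂ × ((SCube D.toTwoRuns → ℝ) × (SCube D.toTwoRuns → ℂ))) × ℂ => (𝔭.DC (printConvention D.toTwoRuns) U).cur k s y a b x q.1.1 q.1.2.1 q.1.2.2 q.2)
        ((sphere (0:ℂ) ((𝔭.DC (printConvention D.toTwoRuns) U).r k) ×ˢ {q | OnContour (𝔭.DC (printConvention D.toTwoRuns) U).κ₁ ((𝔭.DC (printConvention D.toTwoRuns) U).cubes k y a b) q.1 q.2}) ×ˢ sphere (0:ℂ) 1))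
    (hlip : ∀ U, ∀ g ∈ W, ∀ g' ∈ W, ∀ (k : ℕ) (y : ι), ∀ a ∈ (𝔭.DC (printConvention D.toTwoRuns) U).S0 k y, ∀ b ∈ (𝔭.DC (printConvention D.toTwoRuns) U).SY k y a, ∀ (j : ℕ),
      ∀ x ∈ (𝔭.DC (printConvention D.toTwoRuns) U).src k y a j, ∀ t ∈ sphere (0:ℂ) ((𝔭.DC (printConvention D.toTwoRuns) U).r k), ∀ (s' : SCube D.toTwoRuns → ℝ) (σ' : SCube D.toTwoRuns → ℂ),
        OnContour (𝔭.DC (printConvention D.toTwoRuns) U).κ₁ ((𝔭.DC (printConvention D.toTwoRuns) U).cubes k y a b) s' σ' → ∀ τ ∈ ball (0:ℂ) (1 / (2 * (cdir * ℓg k j))),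
          ‖(𝔭.DC (printConvention D.toTwoRuns) U).cur k g y a b x t s' σ' τ - (𝔭.DC (printConvention D.toTwoRuns) U).cur k g' y a b x t s' σ' τ‖ ≤ clipa * ((𝔭.DC (printConvention D.toTwoRuns) U).R x.1 / 2) * |g k - g' k|)
    (hroom : ∀ U, ∀ g ∈ W, ∀ (k : ℕ) (y : ι), ∀ a ∈ (𝔭.DC (printConvention D.toTwoRuns) U).S0 k y, ∀ b ∈ (𝔭.DC (printConvention D.toTwoRuns) U).SY k y a, ∀ (j : ℕ), ∀ x ∈ (𝔭.DC (printConvention D.toTwoRuns) U).src k y a j,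
      ∀ t ∈ sphere (0:ℂ) ((𝔭.DC (printConvention D.toTwoRuns) U).r k), ∀ (s' : SCube D.toTwoRuns → ℝ) (σ' : SCube D.toTwoRuns → ℂ), OnContour (𝔭.DC (printConvention D.toTwoRuns) U).κ₁ ((𝔭.DC (printConvention D.toTwoRuns) U).cubes k y a b) s' σ' →
        ∀ τ ∈ ball (0:ℂ) (1 / (2 * (cdir * ℓg k j))), ‖(𝔭.DC (printConvention D.toTwoRuns) U).cur k g y a b x t s' σ' τ‖ ≤ (𝔭.DC (printConvention D.toTwoRuns) U).R x.1 / 2)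
    -- species (b): the analytic ∕ geometric clauses of `KerData.Admissible` at the data of record, and the letters
    (hzero : ∀ U k s y a b x t s' σ' p q, 𝔭.ker U k s y a b x t s' σ' p q (0 : TowerData (D.F.P (D.K + 1)) o → ℂ) = 0)
    (hkerB : ∀ (U : D.carriers.BgB) (k : ℕ) (s : ℕ → ℝ) (y : ι), ∀ a ∈ boxes D.toTwoRuns k (𝔭.Yout k y), ∀ b ∈ famC D.toTwoRuns (printConvention D.toTwoRuns) k (𝔭.Yout k y) a, ∀ (j : ℕ),
      ∀ x ∈ srcC D.toTwoRuns (printConvention D.toTwoRuns) k a j, ∀ t ∈ sphere (0:ℂ) (𝔭.rT k), ∀ (s' : SCube D.toTwoRuns → ℝ) (σ' : SCube D.toTwoRuns → ℂ),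
        OnContour 𝔭.κ₁ (cubesListC D.toTwoRuns (printConvention D.toTwoRuns) k a b) s' σ' → ∀ p ∈ 𝔭.pts k y a, ∀ q ∈ 𝔭.pts k y a, ∀ (F : TowerData (D.F.P (D.K + 1)) o → ℂ) (M : ℝ),
          DifferentiableOn ℂ F (ball 0 (𝔭.Rad x.1)) → (∀ z ∈ ball (0 : TowerData (D.F.P (D.K + 1)) o) (𝔭.Rad x.1), ‖F z‖ ≤ M) →
            ‖𝔭.ker U k s y a b x t s' σ' p q F‖ ≤
              cK * M * gain k j * 𝔭.ρd p q ^ 𝔭.m * Real.exp (-(δ₀ * (𝔭.dX x.1 p + 𝔭.dX x.1 q))))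
    (hgeom : ∀ (k : ℕ) (y : ι) (a : SCube D.toTwoRuns) (x : (doubleCarriers D.carriers).Dom), ∀ p ∈ 𝔭.pts k y a, ∀ q ∈ 𝔭.pts k y a,
      δ₁ * 𝔭.ρd (𝔭.p0 x.1) p + δ₁ * 𝔭.ρd p q ≤ δ₀ * (𝔭.dX x.1 p + 𝔭.dX x.1 q) + w * D.carriers.d x.1 + w0)
    (hsum0 : ∀ (k : ℕ) (y : ι) (a : SCube D.toTwoRuns) (X : D.carriers.Dom), ∑ p ∈ 𝔭.pts k y a, Real.exp (-(δ₁ * 𝔭.ρd (𝔭.p0 X) p)) ≤ c0)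
    (hsum1 : ∀ (k : ℕ) (y : ι) (a : SCube D.toTwoRuns), ∀ p ∈ 𝔭.pts k y a,
      ∑ q ∈ 𝔭.pts k y a, 𝔭.ρd p q ^ 𝔭.m * Real.exp (-(δ₁ * 𝔭.ρd p q)) ≤ c1)
    (hcK : 0 ≤ cK) (hgain : ∀ k j, 0 ≤ gain k j) (hρd : ∀ p q, 0 ≤ 𝔭.ρd p q) (hc0 : 0 ≤ c0) (hc1 : 0 ≤ c1)
    (hκw : 144 ≤ κ - w) (hLbℓ : ∀ k j, j ≤ k → (1296 : ℝ) * ((D.F.L : ℝ) ^ 4) ^ (k - j) * gain k j ≤ cQb * agePow ω k j)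
    (hAb : ∀ U, PieceAdditiveOn (analyticClass (𝔭.KC (printConvention D.toTwoRuns) U).R) (𝔭.KC (printConvention D.toTwoRuns) U).toC) (hlam : 0 ≤ lam)
    (hkerC : ∀ U, ∀ (k : ℕ) (s : ℕ → ℝ) (y : ι) (a : SCube D.toTwoRuns) (b : Finset (SCube D.toTwoRuns)) (x : (doubleCarriers D.carriers).Dom),
      ∀ p ∈ (𝔭.KC (printConvention D.toTwoRuns) U).pts k y a, ∀ q ∈ (𝔭.KC (printConvention D.toTwoRuns) U).pts k y a, ∀ F : TowerData (D.F.P (D.K + 1)) o → ℂ, DifferentiableOn ℂ F (ball 0 ((𝔭.KC (printConvention D.toTwoRuns) U).R x.1)) →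
        Continuous fun wv : ℂ × (SCube D.toTwoRuns → ℝ) × (SCube D.toTwoRuns → ℂ) => (𝔭.KC (printConvention D.toTwoRuns) U).ker k s y a b x wv.1 wv.2.1 wv.2.2 p q F)
    (hkerL : ∀ U, ∀ g ∈ W, ∀ g' ∈ W, ∀ (k : ℕ) (y : ι), ∀ a ∈ (𝔭.KC (printConvention D.toTwoRuns) U).S0 k y, ∀ b ∈ (𝔭.KC (printConvention D.toTwoRuns) U).SY k y a, ∀ (j : ℕ),
      ∀ x ∈ (𝔭.KC (printConvention D.toTwoRuns) U).src k y a j, ∀ t ∈ sphere (0:ℂ) ((𝔭.KC (printConvention D.toTwoRuns) U).r k), ∀ (s' : SCube D.toTwoRuns → ℝ) (σ' : SCube D.toTwoRuns → ℂ),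
        OnContour (𝔭.KC (printConvention D.toTwoRuns) U).κ₁ ((𝔭.KC (printConvention D.toTwoRuns) U).cubes k y a b) s' σ' → ∀ p ∈ (𝔭.KC (printConvention D.toTwoRuns) U).pts k y a, ∀ q ∈ (𝔭.KC (printConvention D.toTwoRuns) U).pts k y a,
          ∀ (F : TowerData (D.F.P (D.K + 1)) o → ℂ) (M : ℝ), DifferentiableOn ℂ F (ball 0 ((𝔭.KC (printConvention D.toTwoRuns) U).R x.1)) → (∀ z ∈ ball (0 : TowerData (D.F.P (D.K + 1)) o) ((𝔭.KC (printConvention D.toTwoRuns) U).R x.1), ‖F z‖ ≤ M) →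
            ‖(𝔭.KC (printConvention D.toTwoRuns) U).ker k g y a b x t s' σ' p q F - (𝔭.KC (printConvention D.toTwoRuns) U).ker k g' y a b x t s' σ' p q F‖ ≤
              cK * lam * M * gain k j * (𝔭.KC (printConvention D.toTwoRuns) U).ρd p q ^ (𝔭.KC (printConvention D.toTwoRuns) U).m * Real.exp (-(δ₀ * ((𝔭.KC (printConvention D.toTwoRuns) U).dX x.1 p + (𝔭.KC (printConvention D.toTwoRuns) U).dX x.1 q))) *
                |g k - g' k|)
    (hcQa : 0 ≤ cQa) (hcQb : 0 ≤ cQb) (hMF : ∀ U, MF U ⊆ analyticClass (𝔭.DC (printConvention D.toTwoRuns) U).R)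
    -- the recursion data, per chart
    (U₀ : D.carriers.BgB → TowerData (D.F.P (D.K + 1)) o)
    (explZ : D.carriers.BgB → ℕ → TowerData (D.F.P (D.K + 1)) o → (doubleCarriers D.carriers).Dom → ℝ)
    (base : D.carriers.BgB → TowerData (D.F.P (D.K + 1)) o → (doubleCarriers D.carriers).Dom → ℝ)
    (hAdm : ∀ U, AdmissibleTerms (EfOf (GoR D) (actOR D ιR cR aR sR P 𝒵 dom Jc VR mI L dk gc pQ pR ρ cc wR U) (weightOf (𝔭.DC (printConvention D.toTwoRuns) U).toC.frame (𝔭.DC (printConvention D.toTwoRuns) U).κ₁ (1 + (printConvention D.toTwoRuns).nA + (printConvention D.toTwoRuns).nB) (2 * (2 ^ 20 + 1)) ((𝔭.DC (printConvention D.toTwoRuns) U).Kp cdir + (𝔭.KC (printConvention D.toTwoRuns) U).Kp cK w0 c0 c1))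
      (U₀ U) (explZ U) (base U) (cpieceChannel (𝔭.DC (printConvention D.toTwoRuns) U).toC + cpieceChannel (𝔭.KC (printConvention D.toTwoRuns) U).toC) (margProj (r U) (A U))) W (Adm U))
    (hres : ∀ U, AdmRestrict (Adm U))
    (hrA : ∀ U, ReadAdditive (Adm U) (r U)) (hr0 : ∀ U, ReadZero (r U)) (hrs : ∀ U, ReadSize (Adm U) (r U) κ cr)
    (hA : ∀ U, DirSize (A U) κ aA) (hcr : 0 ≤ cr) (haA : 0 ≤ aA) (hPinto : ∀ U, ProjInto (Adm U) (MF U) (margProj (r U) (A U)))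
    (hclip0 : ∀ k, 0 ≤ clip k)
    (hCup : ∀ U, ∀ g ∈ W, ∀ g' ∈ W, ∀ (k : ℕ) (Vc : TowerData (D.F.P (D.K + 1)) o) (X : (doubleCarriers D.carriers).Dom), (doubleCarriers D.carriers).scale X = k + 1 →
      ∀ Q ∈ admOf (GoR D) (actOR D ιR cR aR sR P 𝒵 dom Jc VR mI L dk gc pQ pR ρ cc wR U) (weightOf (𝔭.DC (printConvention D.toTwoRuns) U).toC.frame (𝔭.DC (printConvention D.toTwoRuns) U).κ₁ (1 + (printConvention D.toTwoRuns).nA + (printConvention D.toTwoRuns).nB) (2 * (2 ^ 20 + 1)) ((𝔭.DC (printConvention D.toTwoRuns) U).Kp cdir + (𝔭.KC (printConvention D.toTwoRuns) U).Kp cK w0 c0 c1)) (U₀ U) (explZ U)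
        (base U) (cpieceChannel (𝔭.DC (printConvention D.toTwoRuns) U).toC + cpieceChannel (𝔭.KC (printConvention D.toTwoRuns) U).toC) (margProj (r U) (A U)) W
        (fun k => sizeRadius (fun k j => (1 + cr * aA) * (tauOfG cQa (agePow ω) + tauOfG cQb (agePow ω)) k j) N k) k,
      ∀ γ' ∈ (GoR D).vol X,
        ‖actOR D ιR cR aR sR P 𝒵 dom Jc VR mI L dk gc pQ pR ρ cc wR U k (g k) Vc Q γ'‖ ≤ n U k (g' k) Vc γ' ∧
          ‖actOR D ιR cR aR sR P 𝒵 dom Jc VR mI L dk gc pQ pR ρ cc wR U k (g k) Vc Q γ' -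
              actOR D ιR cR aR sR P 𝒵 dom Jc VR mI L dk gc pQ pR ρ cc wR U k (g' k) Vc Q γ'‖ ≤ clip k * |g k - g' k| * n U k (g' k) Vc γ')
    (hclipb : ∀ k, clip k ≤ clipbar) (hNb : ∀ j, N j ≤ Nbar)
    (hqTb : (64 * clipa * cQa + lam * cQb) * ((1 + cr * aA) * Nbar) * (1 - ω)⁻¹ ≤ qTbar)
    (hKP : ∀ U, TwoPointKP (GoR D) W (actOR D ιR cR aR sR P 𝒵 dom Jc VR mI L dk gc pQ pR ρ cc wR U) (admOf (GoR D) (actOR D ιR cR aR sR P 𝒵 dom Jc VR mI L dk gc pQ pR ρ cc wR U) (weightOf (𝔭.DC (printConvention D.toTwoRuns) U).toC.frame (𝔭.DC (printConvention D.toTwoRuns) U).κ₁ (1 + (printConvention D.toTwoRuns).nA + (printConvention D.toTwoRuns).nB) (2 * (2 ^ 20 + 1)) ((𝔭.DC (printConvention D.toTwoRuns) U).Kp cdir + (𝔭.KC (printConvention D.toTwoRuns) U).Kp cK w0 c0 c1))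
      (U₀ U) (explZ U) (base U) (cpieceChannel (𝔭.DC (printConvention D.toTwoRuns) U).toC + cpieceChannel (𝔭.KC (printConvention D.toTwoRuns) U).toC) (margProj (r U) (A U)) W
      (fun k => sizeRadius (fun k j => (1 + cr * aA) * (tauOfG cQa (agePow ω) + tauOfG cQb (agePow ω)) k j) N k)) (n U) lip a d)
    (hdec : (GoR D).DecayExtract δv d) (hpin : (GoR D).PinBudget a δv (fun _ => B) κ)
    (hexplZ : ∀ U, ∀ (k : ℕ) (Vc : TowerData (D.F.P (D.K + 1)) o) (X : (doubleCarriers D.carriers).Dom), (doubleCarriers D.carriers).scale X = k + 1 →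
      |explZ U k Vc X| ≤ Real.exp (-(κ * (doubleCarriers D.carriers).d X)) * p₀ k)
    (hbase0 : ∀ U, ∀ (Vc : TowerData (D.F.P (D.K + 1)) o) (X : (doubleCarriers D.carriers).Dom), (doubleCarriers D.carriers).scale X = 0 →
      |base U Vc X| ≤ Real.exp (-(κ * (doubleCarriers D.carriers).d X)) * N 0)
    (hNsucc : ∀ j, p₀ j + 2 * B ≤ N (j + 1)) (hNnn : ∀ j, 0 ≤ N j)
    (hB : 0 ≤ B) (hlipb : ∀ k, lip k ≤ lipbar) (hω : 0 ≤ ω) (hω1 : ω < 1)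
    (hpos : 0 < ω + 8 * lipbar * B * ((1 + cr * aA) * (cQa + cQb))) :
    TermSize (EreOf (GoR D) (actOR D ιR cR aR sR P 𝒵 dom Jc VR mI L dk gc pQ pR ρ cc wR) (fun U => weightOf (𝔭.DC (printConvention D.toTwoRuns) U).toC.frame (𝔭.DC (printConvention D.toTwoRuns) U).κ₁ (1 + (printConvention D.toTwoRuns).nA + (printConvention D.toTwoRuns).nB) (2 * (2 ^ 20 + 1)) ((𝔭.DC (printConvention D.toTwoRuns) U).Kp cdir + (𝔭.KC (printConvention D.toTwoRuns) U).Kp cK w0 c0 c1)) U₀ explZ base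
        (fun U => cpieceChannel (𝔭.DC (printConvention D.toTwoRuns) U).toC + cpieceChannel (𝔭.KC (printConvention D.toTwoRuns) U).toC) (fun U => margProj (r U) (A U)) (fun _ => 0)) W κ N ∧
      NE9 (EreOf (GoR D) (actOR D ιR cR aR sR P 𝒵 dom Jc VR mI L dk gc pQ pR ρ cc wR) (fun U => weightOf (𝔭.DC (printConvention D.toTwoRuns) U).toC.frame (𝔭.DC (printConvention D.toTwoRuns) U).κ₁ (1 + (printConvention D.toTwoRuns).nA + (printConvention D.toTwoRuns).nB) (2 * (2 ^ 20 + 1)) ((𝔭.DC (printConvention D.toTwoRuns) U).Kp cdir + (𝔭.KC (printConvention D.toTwoRuns) U).Kp cK w0 c0 c1)) U₀ explZ base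
        (fun U => cpieceChannel (𝔭.DC (printConvention D.toTwoRuns) U).toC + cpieceChannel (𝔭.KC (printConvention D.toTwoRuns) U).toC) (fun U => margProj (r U) (A U)) (fun _ => 0)) W κ
        (prodModuli (8 * clipbar * B + 8 * lipbar * B * qTbar) fun _ => ω + 8 * lipbar * B * ((1 + cr * aA) * (cQa + cQb))) ∧
        FadingMemory ((8 * clipbar * B + 8 * lipbar * B * qTbar) / (ω + 8 * lipbar * B * ((1 + cr * aA) * (cQa + cQb))))
          (ω + 8 * lipbar * B * ((1 + cr * aA) * (cQa + cQb)))
          (prodModuli (8 * clipbar * B + 8 * lipbar * B * qTbar)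
            fun _ => ω + 8 * lipbar * B * ((1 + cr * aA) * (cQa + cQb))) :=
  termSize_ne9_and_fadingMemory_print D ιR cR aR sR P 𝒵 dom Jc VR mI L dk gc pQ pR ρ cc wR U₁ (fun _ => 0) 𝔭 ℓk hκ₁1 hrT hRad hcur
    hϱgt hϱinv hℓ hκ hκ₁ hLaℓ hAa hclipa hcdir hhalf hcont hlip hroom hzero hkerB hgeom hsum0 hsum1 hcK hgain hρd hc0 hc1 hκw hLbℓ hAb
    hlam hkerC hkerL hcQa hcQb hMF U₀ explZ base hAdm hres hrA hr0 hrs hA hcr haA hPinto hclip0 hCup hclipb hNb hqTb hKP hdec hpin hexplZ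
    hbase0 hNsucc hNnn hB hlipb hω hω1 hpos

/-! ## §5 (v1.1) The letters read through the tower data: the centre agreement without reading hypotheses -/

/-- DATA: **THE LETTERS WITH RUN B's TABLES READ THROUGH THE TOWER DATA** — `L` with `dkB ∕ gcB ∕ pQB ∕ pRB` replaced by the readings of the
chart-level tables `dk gc pQ pR` at `(towerDataOf U, adjOf ∘ towerDataOf U)` (every other letter of `L` unchanged).  This is the letter choice
under which run B's raw record of record IS the chart-level record on the real slice (`SubstrateTransporterSpecies.rawOfRecord_eq_rawTOfRecord`).
[cite: Balaban1985BackgroundPropagators, Sect. B pp.399-400] -/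
def SlotLetters.readB : SlotLetters D (o := o) (T := T) (ι' := ι') (S := S) (Ω := Ω) (𝒴 := 𝒴) P (IOp := IOp) 𝒵 dom Jc VR mI :=
  { L with
    dkB := fun U k => dk (towerDataOf (D.F.P (D.K + 1)) ιR D.avB U) (fun k => adjOf (towerDataOf (D.F.P (D.K + 1)) ιR D.avB U k)) k
    gcB := fun U k => gc (towerDataOf (D.F.P (D.K + 1)) ιR D.avB U) (fun k => adjOf (towerDataOf (D.F.P (D.K + 1)) ιR D.avB U k)) k
    pQB := fun r U k => pQ r (towerDataOf (D.F.P (D.K + 1)) ιR D.avB U) (fun k => adjOf (towerDataOf (D.F.P (D.K + 1)) ιR D.avB U k)) k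
    pRB := fun r U k => pR r (towerDataOf (D.F.P (D.K + 1)) ιR D.avB U) (fun k => adjOf (towerDataOf (D.F.P (D.K + 1)) ιR D.avB U k)) k }

/-- **REAL-SLICE AGREEMENT AT THE CENTRE, NO READING HYPOTHESIS.**  At the letters `L.readB dk gc pQ pR`, for unitary-valued `ιR` and `0 ≤ ρ`:
`actOR … (L.readB …) dk gc pQ pR ρ cc w U k s 0 Q = actNE9 (slotsOfRecord … (L.readB …)) (oRecLast (slotsOfRecord … (L.readB …))) (k s _ Q ↦ iRecC P cc w k s 0 Q) k s U Q`
— §1 with its four reading hypotheses discharged by `rfl`. [cite: Balaban1985BackgroundPropagators, Sect. B pp.399-400; Balaban1988RG2Cluster, (2.14) p.15] -/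
theorem actOR_zero_readB (hι : ∀ g, ιR g ∈ Matrix.unitaryGroup o ℂ) (hρ : 0 ≤ ρ) (U : D.carriers.BgB) (k : ℕ) (s : ℝ) (Q : lp (fun _ : ι => ℂ) ∞) :
    actOR D ιR cR aR sR P 𝒵 dom Jc VR mI (SlotLetters.readB D ιR P 𝒵 dom Jc VR mI L dk gc pQ pR) dk gc pQ pR ρ cc wR U k s 0 Q =
      actNE9 (slotsOfRecord D ιR cR aR sR P 𝒵 dom Jc VR mI (SlotLetters.readB D ιR P 𝒵 dom Jc VR mI L dk gc pQ pR))
        (oRecLast (slotsOfRecord D ιR cR aR sR P 𝒵 dom Jc VR mI (SlotLetters.readB D ιR P 𝒵 dom Jc VR mI L dk gc pQ pR)))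
        (fun k s (_ : D.carriers.BgB) Q => iRecC P cc wR k s (0 : TowerData (D.F.P (D.K + 1)) o) Q) k s U Q :=
  actOR_zero D ιR cR aR sR P 𝒵 dom Jc VR mI (SlotLetters.readB D ιR P 𝒵 dom Jc VR mI L dk gc pQ pR) dk gc pQ pR ρ cc wR hι hρ
    rfl rfl rfl rfl U k s Q

end Summit.QuantumFields.BalabanUV.T4Continuum.NE9EndOfRecordCentre

end
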